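/-
Copyright (c) 2026. All rights reserved.
Released under Apache 2.0 license as described in the file LICENSE.
Authors: HodgeCM publication cell (pub-hodgecm), model-construction sub-cell, discharge seat `mc-discharge-2`.
-/
import Literature.NumberTheory.Automorphic.UnitaryGroupDualPairCarriers
import HarnessLib

/-!
# Finite-adelic unitary elements act trivially on the archimedean vectors of `Sp(𝕎_𝔸)`

Topic `NumberTheory/Automorphic`; namespace `Literature.NumberTheory.Automorphic.UnitaryGroup`. Kernel glue over the
constructed embeddings `U(J)(𝔸_F) → Sp_{2N}(𝔸_F)` and `U(J_V ⊗ J_W)(𝔸_F) → Sp(𝕎_𝔸)` of `UnitaryGroupSymplecticCarriers` /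
`UnitaryGroupDualPairCarriers` (Gelbart–Rogawski 1991 §3.1, `G(𝐀) ⊂ Sp_𝐀(W)`): definitions none, every statement
proved, no named fact.

`𝔸_F = F_∞ × 𝔸_F^∞` and `𝔸_E = E_∞ × 𝔸_E^∞` are literal products (Mathlib `AdeleRing`), and the base change
`𝔸_F → 𝔸_E` is componentwise (`AdeleRing.baseChange = prodMap`, tree `AdeleBaseChange`). Call a vector of `𝔸_F^ι`
(resp. `𝔸_E^n`) ARCHIMEDEAN if all its finite components vanish, and an adelic matrix `g ∈ M_n(𝔸_E)` FINITE if its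
archimedean component is the identity matrix (`(g i j).1 = δ_{ij}`; e.g. `GLn.ofFinite k`, `GLn.coe_ofFinite_apply`).

* §1 `Matrix.mulVec_eq_self_of_fst_eq_one`: a finite matrix fixes every archimedean vector (`g x = x`).
* §2 in quadratic coordinates `𝔸_E = 𝔸_F ⊕ 𝔸_F δ` over the base change (`IsQuadraticCoordinates (AdeleRing.baseChange F E) Ψ δ d`,
  e.g. `isQuadraticCoordinates_adele`): archimedean `𝔸_F`-coordinates give an archimedean `𝔸_E`-vector
  (`snd_reIm_symm_apply_eq_zero`), hence **`IsQuadraticCoordinates.toSymplectic_apply_eq_self_of_fst_eq_one`**: for a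
  finite `g ∈ U(σ, H)(𝔸)` the symplectic automorphism `toSymplectic g` of `𝔸_F^n × 𝔸_F^n` FIXES every archimedean vector.
* §3 instances on the carriers of record: `adelicToSymplectic (finAdelicToAdelic k)` (`U(J)(𝔸_{F,f}) ∋ k ↦ (1, k)`,
  `UnitaryGroupRestrictedProduct.finAdelicToAdelic`) and, for the dual pair,
  **`adelicPairToSymplectic (dualPair (finAdelicToAdelic k, finAdelicToAdelic u))`** (matrix
  `ofFinite k ⊗ₖ ofFinite u`, archimedean component `1 ⊗ₖ 1 = 1`) fix every archimedean vector of `𝕎_𝔸`; the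
  one-sided cases `u = 1` / `k = 1` are the special cases `finAdelicToAdelic 1 = 1`.

USE (pub-hodgecm model layer; Weil-representation files of the tree): this is the hypothesis `harch`
("the symplectic component of `s(k)` fixes the archimedean vectors `(archVec a, archVec w)`", `archVec a = piAdeleSplit (a, 0)`
has zero finite part) of `Weil1964/AdelicMetaplecticFinRep.finRepMp`, `FiniteWeilLevelFixing`,
`SchwartzIndicatorDeepLevelFixed`, at the finite-adelic points of the unitary dual pair — the group-side input
under which a deep principal congruence level `K_{U,f}(𝔪)` fixes the theta test functions `Φ_∞ ⊗ 𝟙_{x₀+𝔫𝒪̂}`.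

References (provenance only): S. Gelbart, J. Rogawski, Invent. Math. 105 (1991), §3.1 p. 454 (`G(𝐀) ⊂ Sp_𝐀(W)`,
`W = Res_{E/F} V`); A. Borel, H. Jacquet, Proc. Sympos. Pure Math. 33.1 (1979), §4.1 (`G(𝔸) = G_∞ × G(𝔸_f)`).
-/

noncomputable section

open Matrix NumberField IsDedekindDomain
open scoped Kronecker

namespace Literature.NumberTheory.Automorphic

namespace UnitaryGroup

/-! ## §1. A finite adelic matrix fixes every archimedean vector -/

section MulVec

variable {E : Type} [Field E] [NumberField E] {n : Type*} [Fintype n] [DecidableEq n]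

/-- **A matrix over `𝔸_E` whose archimedean component is `1` fixes every vector with zero finite components**:
`(g x)_i = Σ_j g_{ij} x_j` has archimedean part `Σ_j δ_{ij} (x_j)_∞ = (x_i)_∞` and finite part `Σ_j (g_{ij})_f · 0 = 0`
(computed through the projections `adeleFst`, `adeleSnd`). [folklore] -/
theorem _root_.Matrix.mulVec_eq_self_of_fst_eq_one (g : Matrix n n (AdeleRing (𝓞 E) E))
    (hg : ∀ i j, (g i j).1 = (1 : Matrix n n (InfiniteAdeleRing E)) i j) (x : n → AdeleRing (𝓞 E) E)
    (hx : ∀ i, (x i).2 = 0) : g *ᵥ x = x := by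
  funext i
  refine Prod.ext ?_ ?_
  · change adeleFst E ((g *ᵥ x) i) = adeleFst E (x i)
    have hg' : ∀ j, adeleFst E (g i j) = (1 : Matrix n n (InfiniteAdeleRing E)) i j := hg i
    rw [Matrix.mulVec, dotProduct, map_sum]
    simp only [map_mul, hg', Matrix.one_apply, ite_mul, one_mul, zero_mul, Finset.sum_ite_eq, Finset.mem_univ,
      if_true]
  · change adeleSnd E ((g *ᵥ x) i) = adeleSnd E (x i)
    have hx' : ∀ j, adeleSnd E (x j) = 0 := hx
    rw [Matrix.mulVec, dotProduct, map_sum]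
    simp only [map_mul, hx', mul_zero, Finset.sum_const_zero]

omit [Fintype n] in
/-- The identity matrix is finite: `((1 : M_n(𝔸_E)) i j).1 = δ_{ij}`. [folklore] -/
theorem fst_matrix_one_apply (i j : n) :
    ((1 : Matrix n n (AdeleRing (𝓞 E) E)) i j).1 = (1 : Matrix n n (InfiniteAdeleRing E)) i j := by
  rw [Matrix.one_apply, Matrix.one_apply]
  split_ifs <;> rfl

omit [Fintype n] in
/-- Finite matrices are closed under the Kronecker product: if `g`, `g'` have archimedean component `1`, so does
`g ⊗ₖ g'` (`1 ⊗ₖ 1 = 1`). [folklore] -/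
theorem fst_kronecker_apply_of_fst_eq_one {m : Type*} [DecidableEq m]
    {g : Matrix n n (AdeleRing (𝓞 E) E)} {g' : Matrix m m (AdeleRing (𝓞 E) E)}
    (hg : ∀ i j, (g i j).1 = (1 : Matrix n n (InfiniteAdeleRing E)) i j)
    (hg' : ∀ i j, (g' i j).1 = (1 : Matrix m m (InfiniteAdeleRing E)) i j) (p q : n × m) :
    ((g ⊗ₖ g') p q).1 = (1 : Matrix (n × m) (n × m) (InfiniteAdeleRing E)) p q := by
  rw [Matrix.kroneckerMap_apply, ← Matrix.one_kronecker_one, Matrix.kroneckerMap_apply, ← hg, ← hg']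
  rfl

/-- The finite embedding `GL_N(𝔸_E^∞) ∋ k ↦ (1, k)` produces finite matrices. [folklore] -/
theorem fst_coe_ofFinite_apply {N : ℕ} (k : GL (Fin N) (FiniteAdeleRing (𝓞 E) E)) (i j : Fin N) :
    ((GLn.ofFinite N E k : Matrix (Fin N) (Fin N) (AdeleRing (𝓞 E) E)) i j).1 =
      (1 : Matrix (Fin N) (Fin N) (InfiniteAdeleRing E)) i j := by
  rw [GLn.coe_ofFinite_apply]

end MulVec

/-! ## §2. Quadratic coordinates over the base change: `toSymplectic g` fixes archimedean vectors -/

section Coordinates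

variable {F E : Type} [Field F] [NumberField F] [Field E] [NumberField E] [Algebra F E]
variable {Ψ : (AdeleRing (𝓞 F) F × AdeleRing (𝓞 F) F) ≃+ AdeleRing (𝓞 E) E} {δ : AdeleRing (𝓞 E) E}
  {d : AdeleRing (𝓞 F) F} (h : IsQuadraticCoordinates (AdeleRing.baseChange F E) Ψ δ d)
include h

/-- Archimedean coordinates give an archimedean point: `(Ψ (a, b))_f = (a ⊗ 1)_f + (b ⊗ 1)_f δ_f = 0` when
`a_f = b_f = 0` (the base change of adeles is componentwise). [folklore] -/
theorem IsQuadraticCoordinates.snd_apply_eq_zero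
    {a b : AdeleRing (𝓞 F) F} (ha : a.2 = 0) (hb : b.2 = 0) : (Ψ (a, b)).2 = 0 := by
  rw [h.apply]
  change (AdeleRing.baseChange F E a).2 + (AdeleRing.baseChange F E b).2 * δ.2 = 0
  rw [AdeleRing.baseChange_snd, AdeleRing.baseChange_snd, ha, hb, map_zero, zero_mul, add_zero]

variable {n : Type*}

/-- In particular the `𝔸_E`-vector with archimedean coordinate vectors `(V₁, V₂)` is archimedean. [folklore] -/
theorem IsQuadraticCoordinates.snd_reIm_symm_apply_eq_zero
    (V : (n → AdeleRing (𝓞 F) F) × (n → AdeleRing (𝓞 F) F)) (hV₁ : ∀ i, (V.1 i).2 = 0) (hV₂ : ∀ i, (V.2 i).2 = 0)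
    (i : n) : ((QuadraticCoordinates.reIm Ψ n).symm V i).2 = 0 :=
  h.snd_apply_eq_zero (hV₁ i) (hV₂ i)

variable [Fintype n] [DecidableEq n]

/-- **A finite unitary element fixes the archimedean vectors of `𝕎_𝔸`.** For quadratic coordinates over the base
change `𝔸_F → 𝔸_E` and `g ∈ U(σ, H)(𝔸)` with archimedean component `1`, the symplectic automorphism
`toSymplectic g` of `𝔸_F^n × 𝔸_F^n` (restriction of scalars in the polarisation `𝔸_F^n · 1 ⊕ 𝔸_F^n · δ`) fixes every
vector whose finite components vanish (`toSymplectic_reIm`: it acts as `x ↦ g x` on `𝔸_E^n`, and `g x = x` by §1).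
[cite: GelbartRogawski1991, §3.1 p. 454] -/
theorem IsQuadraticCoordinates.toSymplectic_apply_eq_self_of_fst_eq_one
    {T : Matrix n n (AdeleRing (𝓞 F) F)} (hT : T.IsSymm) {σ : AdeleRing (𝓞 E) E →+* AdeleRing (𝓞 E) E}
    (hσφ : ∀ a, σ (AdeleRing.baseChange F E a) = AdeleRing.baseChange F E a) (hσδ : σ δ = -δ)
    {H : Matrix n n (AdeleRing (𝓞 E) E)} (hH : H = T.map (AdeleRing.baseChange F E)) (g : unitaryGroupOfForm σ H)
    (hg : ∀ i j, (((g : GL n (AdeleRing (𝓞 E) E)) : Matrix n n (AdeleRing (𝓞 E) E)) i j).1 =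
      (1 : Matrix n n (InfiniteAdeleRing E)) i j)
    (V : (n → AdeleRing (𝓞 F) F) × (n → AdeleRing (𝓞 F) F)) (hV₁ : ∀ i, (V.1 i).2 = 0) (hV₂ : ∀ i, (V.2 i).2 = 0) :
    (h.toSymplectic n hT hσφ hσδ hH g).1 V = V := by
  have hV : V = QuadraticCoordinates.reIm Ψ n ((QuadraticCoordinates.reIm Ψ n).symm V) :=
    ((QuadraticCoordinates.reIm Ψ n).apply_symm_apply V).symm
  rw [hV, h.toSymplectic_reIm,
    Matrix.mulVec_eq_self_of_fst_eq_one _ hg _ (h.snd_reIm_symm_apply_eq_zero V hV₁ hV₂)]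

end Coordinates

/-! ## §3. The carriers of record: finite-adelic unitary elements fix the archimedean vectors -/

section Instances

variable (F E : Type) [Field F] [NumberField F] [Field E] [NumberField E] [Algebra F E] (c : E ≃ₐ[F] E) (N M : ℕ)
  [Algebra.IsQuadraticExtension F E] {δ : E} (hcδ : c δ = -δ) (hδ : δ ≠ 0) {d : F} (hd : δ * δ = algebraMap F E d)

/-- **`ι_𝔸(1, k)` fixes the archimedean vectors**: for `k ∈ U(J)(𝔸_{F,f})` embedded as `(1, k) ∈ U(J)(𝔸_F)`
(`finAdelicToAdelic`, underlying matrix `GLn.ofFinite k`), the symplectic automorphism `adelicToSymplectic (1, k)` of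
`𝔸_F^N × 𝔸_F^N` fixes every vector with zero finite components. [cite: GelbartRogawski1991, §3.1 p. 454] -/
theorem adelicToSymplectic_finAdelicToAdelic_apply_eq_self {T : Matrix (Fin N) (Fin N) F} (hT : T.IsSymm)
    {J : Matrix (Fin N) (Fin N) E} (hJ : J = T.map (algebraMap F E)) (k : finAdelic F E c N J)
    (V : (Fin N → AdeleRing (𝓞 F) F) × (Fin N → AdeleRing (𝓞 F) F)) (hV₁ : ∀ i, (V.1 i).2 = 0)
    (hV₂ : ∀ i, (V.2 i).2 = 0) :
    (adelicToSymplectic F E c N hcδ hδ hd hT hJ (finAdelicToAdelic F E c N J k)).1 V = V :=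
  (isQuadraticCoordinates_adele E c hcδ hδ hd).toSymplectic_apply_eq_self_of_fst_eq_one _ _ _ _ _
    (fun i j => fst_coe_ofFinite_apply (k : GL (Fin N) (FiniteAdeleRing (𝓞 E) E)) i j) V hV₁ hV₂


/-- **Pair carrier, generic**: an element of `G₁(𝔸_F) = U(J_V ⊗ J_W)(𝔸_F)` whose matrix has archimedean component `1`
acts trivially, through `adelicPairToSymplectic`, on the vectors of `𝕎_𝔸` with zero finite components.
[cite: GelbartRogawski1991, §3.1 p. 454] -/
theorem adelicPairToSymplectic_apply_eq_self_of_fst_eq_one {TV : Matrix (Fin N) (Fin N) F}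
    {TW : Matrix (Fin M) (Fin M) F} (hV : TV.IsSymm) (hW : TW.IsSymm) {JV : Matrix (Fin N) (Fin N) E}
    {JW : Matrix (Fin M) (Fin M) E} (hJV : JV = TV.map (algebraMap F E)) (hJW : JW = TW.map (algebraMap F E))
    (g : adelicPair F E c N M JV JW)
    (hg : ∀ p q, (((g : GL (Fin N × Fin M) (AdeleRing (𝓞 E) E)) :
      Matrix (Fin N × Fin M) (Fin N × Fin M) (AdeleRing (𝓞 E) E)) p q).1 =
        (1 : Matrix (Fin N × Fin M) (Fin N × Fin M) (InfiniteAdeleRing E)) p q)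
    (V : (Fin N × Fin M → AdeleRing (𝓞 F) F) × (Fin N × Fin M → AdeleRing (𝓞 F) F)) (hV₁ : ∀ i, (V.1 i).2 = 0)
    (hV₂ : ∀ i, (V.2 i).2 = 0) :
    (adelicPairToSymplectic F E c N M hcδ hδ hd hV hW hJV hJW g).1 V = V := by
  refine (isQuadraticCoordinates_adele E c hcδ hδ hd).toSymplectic_apply_eq_self_of_fst_eq_one
    (isSymm_kronecker (hV.map _) (hW.map _)) (fun a => ?_) ?_ ?_ g hg V hV₁ hV₂
  · rw [conjAdele_apply, AdeleRing.smul_baseChange]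
  · rw [← algebraMap_conj, RingHom.coe_coe, hcδ, map_neg]
  · rw [adelicForm_eq_map_map E N TV hJV, adelicForm_eq_map_map E M TW hJW, kronecker_map_map]

/-- **The dual pair at finite-adelic elements fixes the archimedean vectors of `𝕎_𝔸`**: for
`k ∈ U(J_V)(𝔸_{F,f})`, `u ∈ U(J_W)(𝔸_{F,f})` the symplectic automorphism `toSp ((1,k) ⊗ (1,u))` of
`𝔸_F^{N M} × 𝔸_F^{N M}` (`adelicPairToSymplectic ∘ dualPair`, matrix `ofFinite k ⊗ₖ ofFinite u`) fixes every vector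
with zero finite components. [cite: GelbartRogawski1991, §3.1 p. 454] -/
theorem adelicPairToSymplectic_dualPair_finAdelicToAdelic_apply_eq_self {TV : Matrix (Fin N) (Fin N) F}
    {TW : Matrix (Fin M) (Fin M) F} (hV : TV.IsSymm) (hW : TW.IsSymm) {JV : Matrix (Fin N) (Fin N) E}
    {JW : Matrix (Fin M) (Fin M) E} (hJV : JV = TV.map (algebraMap F E)) (hJW : JW = TW.map (algebraMap F E))
    (k : finAdelic F E c N JV) (u : finAdelic F E c M JW)
    (V : (Fin N × Fin M → AdeleRing (𝓞 F) F) × (Fin N × Fin M → AdeleRing (𝓞 F) F)) (hV₁ : ∀ i, (V.1 i).2 = 0)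
    (hV₂ : ∀ i, (V.2 i).2 = 0) :
    (adelicPairToSymplectic F E c N M hcδ hδ hd hV hW hJV hJW
        (dualPair (conjAdele F E c) (adelicForm E N JV) (adelicForm E M JW)
          (finAdelicToAdelic F E c N JV k, finAdelicToAdelic F E c M JW u))).1 V = V :=
  adelicPairToSymplectic_apply_eq_self_of_fst_eq_one F E c N M hcδ hδ hd hV hW hJV hJW _
    (fun p q => fst_kronecker_apply_of_fst_eq_one
      (fun i j => fst_coe_ofFinite_apply (k : GL (Fin N) (FiniteAdeleRing (𝓞 E) E)) i j)
      (fun i j => fst_coe_ofFinite_apply (u : GL (Fin M) (FiniteAdeleRing (𝓞 E) E)) i j) p q) V hV₁ hV₂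


/-- The case `u = 1` of `adelicPairToSymplectic_dualPair_finAdelicToAdelic_apply_eq_self`, stated with the literal
`1 ∈ U(J_W)(𝔸_F)` in the second slot (the shape in which pair splittings are evaluated on the `U(J_V)`-member alone).
[cite: GelbartRogawski1991, §3.1 p. 454] -/
theorem adelicPairToSymplectic_dualPair_finAdelicToAdelic_one_apply_eq_self {TV : Matrix (Fin N) (Fin N) F}
    {TW : Matrix (Fin M) (Fin M) F} (hV : TV.IsSymm) (hW : TW.IsSymm) {JV : Matrix (Fin N) (Fin N) E}
    {JW : Matrix (Fin M) (Fin M) E} (hJV : JV = TV.map (algebraMap F E)) (hJW : JW = TW.map (algebraMap F E))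
    (k : finAdelic F E c N JV)
    (V : (Fin N × Fin M → AdeleRing (𝓞 F) F) × (Fin N × Fin M → AdeleRing (𝓞 F) F)) (hV₁ : ∀ i, (V.1 i).2 = 0)
    (hV₂ : ∀ i, (V.2 i).2 = 0) :
    (adelicPairToSymplectic F E c N M hcδ hδ hd hV hW hJV hJW
        (dualPair (conjAdele F E c) (adelicForm E N JV) (adelicForm E M JW)
          (finAdelicToAdelic F E c N JV k, 1))).1 V = V := by
  have h := adelicPairToSymplectic_dualPair_finAdelicToAdelic_apply_eq_self F E c N M hcδ hδ hd hV hW hJV hJW k 1 V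
    hV₁ hV₂
  rwa [map_one] at h

/-- The case `k = 1`: `toSp (1 ⊗ (1,u))` with the literal `1 ∈ U(J_V)(𝔸_F)` in the first slot.
[cite: GelbartRogawski1991, §3.1 p. 454] -/
theorem adelicPairToSymplectic_dualPair_one_finAdelicToAdelic_apply_eq_self {TV : Matrix (Fin N) (Fin N) F}
    {TW : Matrix (Fin M) (Fin M) F} (hV : TV.IsSymm) (hW : TW.IsSymm) {JV : Matrix (Fin N) (Fin N) E}
    {JW : Matrix (Fin M) (Fin M) E} (hJV : JV = TV.map (algebraMap F E)) (hJW : JW = TW.map (algebraMap F E))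
    (u : finAdelic F E c M JW)
    (V : (Fin N × Fin M → AdeleRing (𝓞 F) F) × (Fin N × Fin M → AdeleRing (𝓞 F) F)) (hV₁ : ∀ i, (V.1 i).2 = 0)
    (hV₂ : ∀ i, (V.2 i).2 = 0) :
    (adelicPairToSymplectic F E c N M hcδ hδ hd hV hW hJV hJW
        (dualPair (conjAdele F E c) (adelicForm E N JV) (adelicForm E M JW)
          (1, finAdelicToAdelic F E c M JW u))).1 V = V := by
  have h := adelicPairToSymplectic_dualPair_finAdelicToAdelic_apply_eq_self F E c N M hcδ hδ hd hV hW hJV hJW 1 u V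
    hV₁ hV₂
  rwa [map_one] at h

/-- One-sided form, `U(J_V)`-member: `toSp ((1,k) ⊗ 1)` (`adelicInl (finAdelicToAdelic k)`) fixes every vector with
zero finite components. [cite: GelbartRogawski1991, §3.1 p. 454] -/
theorem adelicPairToSymplectic_adelicInl_finAdelicToAdelic_apply_eq_self {TV : Matrix (Fin N) (Fin N) F}
    {TW : Matrix (Fin M) (Fin M) F} (hV : TV.IsSymm) (hW : TW.IsSymm) {JV : Matrix (Fin N) (Fin N) E}
    {JW : Matrix (Fin M) (Fin M) E} (hJV : JV = TV.map (algebraMap F E)) (hJW : JW = TW.map (algebraMap F E))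
    (k : finAdelic F E c N JV)
    (V : (Fin N × Fin M → AdeleRing (𝓞 F) F) × (Fin N × Fin M → AdeleRing (𝓞 F) F)) (hV₁ : ∀ i, (V.1 i).2 = 0)
    (hV₂ : ∀ i, (V.2 i).2 = 0) :
    (adelicPairToSymplectic F E c N M hcδ hδ hd hV hW hJV hJW
        (adelicInl F E c N M JV JW (finAdelicToAdelic F E c N JV k))).1 V = V :=
  adelicPairToSymplectic_apply_eq_self_of_fst_eq_one F E c N M hcδ hδ hd hV hW hJV hJW _
    (fun p q => fst_kronecker_apply_of_fst_eq_one
      (fun i j => fst_coe_ofFinite_apply (k : GL (Fin N) (FiniteAdeleRing (𝓞 E) E)) i j)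
      (fun i j => fst_matrix_one_apply i j) p q) V hV₁ hV₂

/-- One-sided form, `U(J_W)`-member: `toSp (1 ⊗ (1,u))` (`adelicInr (finAdelicToAdelic u)`) fixes every vector with
zero finite components. [cite: GelbartRogawski1991, §3.1 p. 454] -/
theorem adelicPairToSymplectic_adelicInr_finAdelicToAdelic_apply_eq_self {TV : Matrix (Fin N) (Fin N) F}
    {TW : Matrix (Fin M) (Fin M) F} (hV : TV.IsSymm) (hW : TW.IsSymm) {JV : Matrix (Fin N) (Fin N) E}
    {JW : Matrix (Fin M) (Fin M) E} (hJV : JV = TV.map (algebraMap F E)) (hJW : JW = TW.map (algebraMap F E))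
    (u : finAdelic F E c M JW)
    (V : (Fin N × Fin M → AdeleRing (𝓞 F) F) × (Fin N × Fin M → AdeleRing (𝓞 F) F)) (hV₁ : ∀ i, (V.1 i).2 = 0)
    (hV₂ : ∀ i, (V.2 i).2 = 0) :
    (adelicPairToSymplectic F E c N M hcδ hδ hd hV hW hJV hJW
        (adelicInr F E c N M JV JW (finAdelicToAdelic F E c M JW u))).1 V = V :=
  adelicPairToSymplectic_apply_eq_self_of_fst_eq_one F E c N M hcδ hδ hd hV hW hJV hJW _
    (fun p q => fst_kronecker_apply_of_fst_eq_one (fun i j => fst_matrix_one_apply i j)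
      (fun i j => fst_coe_ofFinite_apply (u : GL (Fin M) (FiniteAdeleRing (𝓞 E) E)) i j) p q) V hV₁ hV₂

end Instances

end UnitaryGroup

end Literature.NumberTheory.Automorphic
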